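import Literature.Analysis.OperatorTheory.ScalarSpectralMeasure
import Mathlib.Analysis.SpecialFunctions.Pow.Continuity
import Mathlib.Analysis.SpecialFunctions.Log.Basic
import Mathlib.MeasureTheory.Integral.DominatedConvergence
import Mathlib.Analysis.InnerProductSpace.Adjoint
import HarnessLib

/-!
# The Laplace (spectral) representation of a symmetric contraction semigroup

Let `H` be a complex Hilbert space and `S t`, `t > 0`, bounded operators with the semigroup law
`S (s + t) = S s * S t` (`s, t > 0`), each `S t` self-adjoint with `‖S t‖ ≤ 1` (nothing is assumed
at `t = 0`). The classical consequence of the spectral theorem for the (unbounded, self-adjoint,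
nonnegative) generator `A`, `S t = e^{-tA} = ∫ e^{-tE} dE_E` (Yosida, *Functional Analysis*
(1980), IX.13 / XI.; Reed–Simon I Thm VIII.5; Chung–Zhao (1995) §2.4 (35) "spectral resolution
theorem for a semigroup of self-adjoint operators in `L²`"), is, on matrix elements,

`⟪ψ, S t ψ⟫ = ∫ e^{-tE} dμ_ψ(E)`, `‖S t ψ‖² = ∫ e^{-2tE} dμ_ψ(E)` (`t > 0`)

for a finite positive measure `μ_ψ` on `[0, ∞)` of mass `≤ ‖ψ‖²`, with equality of the mass iff
`⟪ψ, S t ψ⟫ → ‖ψ‖²` as `t → 0⁺`. Mathlib has no spectral theorem for unbounded operators; this file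
proves the displayed statement from the continuous functional calculus of the single bounded
positive contraction `S 1` and the scalar spectral measures of
`Literature.Analysis.OperatorTheory.ScalarSpectralMeasure` (the road of
`Literature/MathematicalPhysics/QuantumFieldTheory/OSDistributionSpace{Powers,Laplace}.lean`,
here in abstract form and WITHOUT strong continuity):

* `nonneg`, `sqrt_eq_half` — `0 ≤ S t = (S (t/2))²`, `CFC.sqrt (S t) = S (t/2)`
  (`CFC.sqrt_unique`);
* `dyadic_eq_nnrpow` — `S ((m+1)/2ᵏ) = (S 1) ^ ((m+1)(2⁻¹)ᵏ)` in the `ℝ≥0` functional calculus;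
* `re_inner_dyadic_eq_integral` — the representation on dyadic times in the variable
  `x = e^{-E} ∈ σ(S 1) ⊆ [0, 1]` (`inner_nnrpow_eq_integral`);
* `eq_of_antitone_of_dyadic` — a function antitone on `(0, ∞)` that agrees with a continuous one on
  the positive dyadic rationals agrees with it everywhere on `(0, ∞)`; applied to
  `t ↦ Re ⟪ψ, S t ψ⟫ = ‖S (t/2) ψ‖²` (antitone by the contraction property) this extends the
  representation to all real `t > 0` (`re_inner_eq_integral_rpow`) with no continuity assumption on
  `S`;
* `measure_zero_eq_zero_of_tendsto` — if `Re ⟪ψ, S t ψ⟫ → ‖ψ‖²` as `t → 0⁺` then the spectral measure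
  does not charge `x = 0` (dominated convergence, `x^t → 𝟙{x ≠ 0}`);
* `exists_laplace_measure` — **the Laplace representation**: the push-forward under
  `x ↦ E = -log x` is a finite measure `μ` on `ℝ` with `μ (-∞, 0) = 0`, `μ ℝ = ‖ψ‖²`,
  `⟪ψ, S t ψ⟫ = ∫ e^{-tE} dμ` and `‖S t ψ‖² = ∫ e^{-2tE} dμ` for every `t > 0`.

## References
* K. Yosida, *Functional Analysis* (6th ed. 1980), Ch. IX §13 and Ch. XI (representation of
  semigroups of self-adjoint operators).
* M. Reed, B. Simon, *Methods of Modern Mathematical Physics I* (rev. ed. 1980), §VII.2 (the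
  measures `μ_ψ`), Thm VIII.5. [ReedSimonI1980]
* K. L. Chung, Z. Zhao, *From Brownian Motion to Schrödinger's Equation* (1995), §2.4 (35).
  [ChungZhao1995]
-/

noncomputable section

open MeasureTheory Filter
open _root_.Topology
open scoped InnerProductSpace NNReal ENNReal

-- CFC instance chain on `H →L[ℂ] H` (C⋆-algebra ⟶ CFC over `ℂ` ⟶ `ℝ` ⟶ `ℝ≥0`).
set_option synthInstance.maxHeartbeats 200000

namespace Literature.Analysis.OperatorTheory

namespace SymmContractionSemigroup

variable {H : Type*} [NormedAddCommGroup H] [InnerProductSpace ℂ H] [CompleteSpace H]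
variable {S : ℝ → H →L[ℂ] H}

/-! ### Algebra of a symmetric contraction semigroup -/

/-- Symmetry of the matrix elements: `⟪S t φ, ψ⟫ = ⟪φ, S t ψ⟫` for a self-adjoint `S t`.
[folklore] -/
theorem inner_left_eq (hsa : ∀ t : ℝ, 0 < t → IsSelfAdjoint (S t)) {t : ℝ} (ht : 0 < t)
    (φ ψ : H) : ⟪S t φ, ψ⟫_ℂ = ⟪φ, S t ψ⟫_ℂ := by
  have h := (ContinuousLinearMap.isSelfAdjoint_iff_isSymmetric.1 (hsa t ht)) φ ψ
  simpa only [ContinuousLinearMap.coe_coe] using h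

omit [CompleteSpace H] in
/-- Contraction: `‖S t φ‖ ≤ ‖φ‖`. [folklore] -/
theorem norm_apply_le (hcontr : ∀ t : ℝ, 0 < t → ‖S t‖ ≤ 1) {t : ℝ} (ht : 0 < t) (φ : H) :
    ‖S t φ‖ ≤ ‖φ‖ := by
  simpa only [one_mul] using (S t).le_of_opNorm_le (hcontr t ht) φ

omit [CompleteSpace H] in
/-- The square-root relation `S (t/2) * S (t/2) = S t` (`t > 0`). [folklore] -/
theorem half_mul_half (hadd : ∀ s t : ℝ, 0 < s → 0 < t → S (s + t) = S s * S t) {t : ℝ}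
    (ht : 0 < t) : S (t / 2) * S (t / 2) = S t := by
  rw [← hadd _ _ (half_pos ht) (half_pos ht), add_halves]

/-- **`⟪ψ, S t ψ⟫ = ‖S (t/2) ψ‖²`** (`t > 0`): the diagonal matrix elements are squares of norms.
[folklore] -/
theorem inner_self_eq_norm_sq_half (hadd : ∀ s t : ℝ, 0 < s → 0 < t → S (s + t) = S s * S t)
    (hsa : ∀ t : ℝ, 0 < t → IsSelfAdjoint (S t)) {t : ℝ} (ht : 0 < t) (ψ : H) :
    ⟪ψ, S t ψ⟫_ℂ = ((‖S (t / 2) ψ‖ ^ 2 : ℝ) : ℂ) := by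
  rw [← half_mul_half hadd ht, mul_apply_eq_comp,
    ← inner_left_eq hsa (half_pos ht), inner_self_eq_norm_sq_to_K]
  norm_cast

/-- The diagonal matrix elements are real: `⟪ψ, S t ψ⟫ = Re ⟪ψ, S t ψ⟫`. [folklore] -/
theorem inner_self_eq_re (hadd : ∀ s t : ℝ, 0 < s → 0 < t → S (s + t) = S s * S t)
    (hsa : ∀ t : ℝ, 0 < t → IsSelfAdjoint (S t)) {t : ℝ} (ht : 0 < t) (ψ : H) :
    ⟪ψ, S t ψ⟫_ℂ = ((RCLike.re ⟪ψ, S t ψ⟫_ℂ : ℝ) : ℂ) := by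
  rw [inner_self_eq_norm_sq_half hadd hsa ht]
  simp only [RCLike.re_to_complex, Complex.ofReal_re]

/-- `Re ⟪ψ, S t ψ⟫ = ‖S (t/2) ψ‖²`. [folklore] -/
theorem re_inner_self_eq_norm_sq_half (hadd : ∀ s t : ℝ, 0 < s → 0 < t → S (s + t) = S s * S t)
    (hsa : ∀ t : ℝ, 0 < t → IsSelfAdjoint (S t)) {t : ℝ} (ht : 0 < t) (ψ : H) :
    RCLike.re ⟪ψ, S t ψ⟫_ℂ = ‖S (t / 2) ψ‖ ^ 2 := by
  rw [inner_self_eq_norm_sq_half hadd hsa ht]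
  simp only [RCLike.re_to_complex, Complex.ofReal_re]

/-- **`t ↦ Re ⟪ψ, S t ψ⟫` is antitone on `(0, ∞)`** (contraction: `‖S (t/2) ψ‖ ≤ ‖S (s/2) ψ‖` for
`s ≤ t`). [folklore] -/
theorem re_inner_self_antitone (hadd : ∀ s t : ℝ, 0 < s → 0 < t → S (s + t) = S s * S t)
    (hsa : ∀ t : ℝ, 0 < t → IsSelfAdjoint (S t)) (hcontr : ∀ t : ℝ, 0 < t → ‖S t‖ ≤ 1) (ψ : H)
    {s t : ℝ} (hs : 0 < s) (hst : s ≤ t) :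
    RCLike.re ⟪ψ, S t ψ⟫_ℂ ≤ RCLike.re ⟪ψ, S s ψ⟫_ℂ := by
  have ht : 0 < t := hs.trans_le hst
  rw [re_inner_self_eq_norm_sq_half hadd hsa ht, re_inner_self_eq_norm_sq_half hadd hsa hs]
  refine pow_le_pow_left₀ (norm_nonneg _) ?_ 2
  rcases eq_or_lt_of_le hst with rfl | hlt
  · exact le_rfl
  · have h : S (t / 2) ψ = S ((t - s) / 2) (S (s / 2) ψ) := by
      rw [← mul_apply_eq_comp, ← hadd _ _ (by linarith) (half_pos hs)]
      congr 2; ring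
    rw [h]
    exact norm_apply_le hcontr (by linarith) _

/-- **`0 ≤ S t`** in the Loewner order of `H →L[ℂ] H`: `S t = (S (t/2))⋆ (S (t/2))`. [folklore] -/
theorem nonneg (hadd : ∀ s t : ℝ, 0 < s → 0 < t → S (s + t) = S s * S t)
    (hsa : ∀ t : ℝ, 0 < t → IsSelfAdjoint (S t)) {t : ℝ} (ht : 0 < t) : 0 ≤ S t := by
  rw [← half_mul_half hadd ht]
  nth_rewrite 1 [← (hsa _ (half_pos ht)).star_eq]
  exact star_mul_self_nonneg _

/-- **`CFC.sqrt (S t) = S (t/2)`**: uniqueness of the positive square root in the C⋆-algebra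
`H →L[ℂ] H` (`CFC.sqrt_unique`). [folklore] -/
theorem sqrt_eq_half (hadd : ∀ s t : ℝ, 0 < s → 0 < t → S (s + t) = S s * S t)
    (hsa : ∀ t : ℝ, 0 < t → IsSelfAdjoint (S t)) {t : ℝ} (ht : 0 < t) :
    CFC.sqrt (S t) = S (t / 2) :=
  CFC.sqrt_unique (half_mul_half hadd ht) (nonneg hadd hsa (half_pos ht))

/-- **`S (t/2ᵏ) = (S t) ^ ((2⁻¹)ᵏ)`** (CFC power, exponent in `ℝ≥0`), iterating `sqrt_eq_half` and
`CFC.sqrt_nnrpow`. [folklore] -/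
theorem div_two_pow_eq_nnrpow (hadd : ∀ s t : ℝ, 0 < s → 0 < t → S (s + t) = S s * S t)
    (hsa : ∀ t : ℝ, 0 < t → IsSelfAdjoint (S t)) {t : ℝ} (ht : 0 < t) (k : ℕ) :
    S (t / 2 ^ k) = S t ^ ((2⁻¹ : ℝ≥0) ^ k) := by
  induction k with
  | zero =>
    rw [pow_zero, pow_zero, div_one, CFC.nnrpow_one (S t) (nonneg hadd hsa ht)]
  | succ k ih =>
    have h1 : t / 2 ^ (k + 1) = t / 2 ^ k / 2 := by rw [pow_succ, div_div]
    rw [h1, ← sqrt_eq_half hadd hsa (by positivity), ih, CFC.sqrt_nnrpow, pow_succ,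
      div_eq_mul_inv]

omit [CompleteSpace H] in
/-- **Positive powers are multiples of the time**: `(S t)^(m+1) = S ((m+1) t)` for `t > 0`.
[folklore] -/
theorem pow_succ_eq (hadd : ∀ s t : ℝ, 0 < s → 0 < t → S (s + t) = S s * S t) {t : ℝ}
    (ht : 0 < t) (m : ℕ) : S t ^ (m + 1) = S ((m + 1 : ℕ) * t) := by
  induction m with
  | zero => simp
  | succ m ih =>
    rw [pow_succ, ih, ← hadd _ _ (by positivity) ht]
    congr 1
    push_cast
    ring

/-- Natural powers of CFC powers with positive exponent: `(a ^ x) ^ (m + 1) = a ^ ((m + 1) x)`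
(`CFC.nnrpow_add`). [folklore] -/
theorem nnrpow_pow_succ (a : H →L[ℂ] H) {x : ℝ≥0} (hx : 0 < x) (m : ℕ) :
    (a ^ x) ^ (m + 1) = a ^ (((m : ℝ≥0) + 1) * x) := by
  induction m with
  | zero => simp
  | succ m ih =>
    rw [pow_succ, ih, Nat.cast_succ]
    have hpos : 0 < ((m : ℝ≥0) + 1) * x := mul_pos (by positivity) hx
    rw [show ((m : ℝ≥0) + 1 + 1) * x = ((m : ℝ≥0) + 1) * x + x by ring, CFC.nnrpow_add hpos hx]

/-- **The semigroup on dyadic multiples is a CFC power of one member**: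
`S ((m+1) t/2ᵏ) = (S t) ^ ((m+1)(2⁻¹)ᵏ)`. [folklore] -/
theorem dyadic_mul_eq_nnrpow (hadd : ∀ s t : ℝ, 0 < s → 0 < t → S (s + t) = S s * S t)
    (hsa : ∀ t : ℝ, 0 < t → IsSelfAdjoint (S t)) {t : ℝ} (ht : 0 < t) (m k : ℕ) :
    S ((m + 1 : ℕ) * (t / 2 ^ k)) = S t ^ (((m : ℝ≥0) + 1) * (2⁻¹ : ℝ≥0) ^ k) := by
  rw [← pow_succ_eq hadd (by positivity) m, div_two_pow_eq_nnrpow hadd hsa ht k,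
    nnrpow_pow_succ _ (by positivity) m]

/-- **`S q = (S 1)^q` for positive dyadic `q = (m+1)/2ᵏ`** (Yosida IX.13 / Chung–Zhao §2.4 (35)
read through the functional calculus of the bounded positive contraction `S 1`). [folklore] -/
theorem dyadic_eq_nnrpow (hadd : ∀ s t : ℝ, 0 < s → 0 < t → S (s + t) = S s * S t)
    (hsa : ∀ t : ℝ, 0 < t → IsSelfAdjoint (S t)) (m k : ℕ) :
    S ((m + 1 : ℕ) / 2 ^ k : ℝ) = S 1 ^ (((m : ℝ≥0) + 1) * (2⁻¹ : ℝ≥0) ^ k) := by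
  rw [← dyadic_mul_eq_nnrpow hadd hsa one_pos m k]
  congr 1
  ring

/-! ### The spectral measure of `S 1` and the representation on dyadic times -/

/-- **The spectrum of a positive contraction lies in `[0, 1]`.** [folklore] -/
theorem spectrum_subset_Icc {A : H →L[ℂ] H} (h0 : 0 ≤ A) (h1 : ‖A‖ ≤ 1) :
    spectrum ℝ A ⊆ Set.Icc 0 1 := by
  intro x hx
  refine ⟨spectrum_nonneg_of_nonneg h0 hx, ?_⟩
  have hxC : (algebraMap ℝ ℂ x) ∈ spectrum ℂ A := (spectrum.algebraMap_mem_iff ℂ).2 hx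
  have h := spectrum.norm_le_norm_mul_of_mem hxC
  have hone : ‖(1 : H →L[ℂ] H)‖ ≤ 1 := ContinuousLinearMap.norm_id_le
  have h2 : ‖algebraMap ℝ ℂ x‖ = |x| := by simp
  rw [h2] at h
  calc x ≤ |x| := le_abs_self x
    _ ≤ ‖A‖ * ‖(1 : H →L[ℂ] H)‖ := h
    _ ≤ 1 * 1 := mul_le_mul h1 hone (norm_nonneg _) zero_le_one
    _ = 1 := mul_one 1

/-- Points of the spectrum of `S 1` have coordinates in `[0, 1]`. [folklore] -/
theorem coe_mem_Icc (hadd : ∀ s t : ℝ, 0 < s → 0 < t → S (s + t) = S s * S t)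
    (hsa : ∀ t : ℝ, 0 < t → IsSelfAdjoint (S t)) (hcontr : ∀ t : ℝ, 0 < t → ‖S t‖ ≤ 1)
    (x : spectrum ℝ (S 1)) : (x : ℝ) ∈ Set.Icc (0 : ℝ) 1 :=
  spectrum_subset_Icc (nonneg hadd hsa one_pos) (hcontr 1 one_pos) x.2

/-- **Representation on dyadic times**: for `q = (m+1)/2ᵏ`,
`Re ⟪ψ, S q ψ⟫ = ∫_{σ(S 1)} x^q dμ_ψ(x)` with `μ_ψ` the scalar spectral measure of `S 1` at `ψ`
(`dyadic_eq_nnrpow` and `inner_nnrpow_eq_integral`). [folklore] -/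
theorem re_inner_dyadic_eq_integral (hadd : ∀ s t : ℝ, 0 < s → 0 < t → S (s + t) = S s * S t)
    (hsa : ∀ t : ℝ, 0 < t → IsSelfAdjoint (S t)) (ψ : H) (m k : ℕ) :
    RCLike.re ⟪ψ, S ((m + 1 : ℕ) / 2 ^ k : ℝ) ψ⟫_ℂ =
      ∫ x, (x : ℝ) ^ ((m + 1 : ℕ) / 2 ^ k : ℝ)
        ∂(scalarSpectralMeasure (S 1) (hsa 1 one_pos) ψ) := by
  have hpos : 0 < ((m : ℝ≥0) + 1) * (2⁻¹ : ℝ≥0) ^ k := by positivity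
  have h := inner_nnrpow_eq_integral (nonneg hadd hsa one_pos) ψ hpos
  rw [← dyadic_eq_nnrpow hadd hsa m k] at h
  have hexp : ((((m : ℝ≥0) + 1) * (2⁻¹ : ℝ≥0) ^ k : ℝ≥0) : ℝ) = ((m + 1 : ℕ) / 2 ^ k : ℝ) := by
    push_cast
    rw [inv_pow, div_eq_mul_inv]
  rw [h, hexp]
  simp only [RCLike.re_to_complex, Complex.ofReal_re]

/-- The integrand bound `|x^s| ≤ 1` on `σ(S 1) ⊆ [0, 1]`, `s ≥ 0`. [folklore] -/
theorem abs_rpow_le_one (hadd : ∀ s t : ℝ, 0 < s → 0 < t → S (s + t) = S s * S t)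
    (hsa : ∀ t : ℝ, 0 < t → IsSelfAdjoint (S t)) (hcontr : ∀ t : ℝ, 0 < t → ‖S t‖ ≤ 1)
    (x : spectrum ℝ (S 1)) {s : ℝ} (hs : 0 ≤ s) : |(x : ℝ) ^ s| ≤ 1 := by
  obtain ⟨h0, h1⟩ := coe_mem_Icc hadd hsa hcontr x
  rw [abs_of_nonneg (Real.rpow_nonneg h0 s)]
  exact Real.rpow_le_one h0 h1 hs

/-- **Continuity of `s ↦ ∫ x^s dμ_ψ(x)` at every `s₀ > 0`** (dominated convergence, `|x^s| ≤ 1`).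
[folklore] -/
theorem continuousAt_integral_rpow (hadd : ∀ s t : ℝ, 0 < s → 0 < t → S (s + t) = S s * S t)
    (hsa : ∀ t : ℝ, 0 < t → IsSelfAdjoint (S t)) (hcontr : ∀ t : ℝ, 0 < t → ‖S t‖ ≤ 1)
    (ψ : H) {s₀ : ℝ} (hs₀ : 0 < s₀) :
    ContinuousAt (fun s : ℝ => ∫ x, (x : ℝ) ^ s
      ∂(scalarSpectralMeasure (S 1) (hsa 1 one_pos) ψ)) s₀ := by
  have hmeas : ∀ s : ℝ, 0 < s →
      AEStronglyMeasurable (fun x : spectrum ℝ (S 1) => (x : ℝ) ^ s)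
        (scalarSpectralMeasure (S 1) (hsa 1 one_pos) ψ) := fun s hs =>
    (continuous_subtype_val.rpow_const fun x => Or.inr hs.le).aestronglyMeasurable
  refine continuousAt_of_dominated (bound := fun _ => 1) ?_ ?_ (integrable_const 1) ?_
  · filter_upwards [Ioi_mem_nhds hs₀] with s hs using hmeas s hs
  · filter_upwards [Ioi_mem_nhds hs₀] with s hs
    exact Eventually.of_forall fun x => by
      rw [Real.norm_eq_abs]
      exact abs_rpow_le_one hadd hsa hcontr x (le_of_lt hs)
  · exact Eventually.of_forall fun x => Real.continuousAt_const_rpow' hs₀.ne'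

/-! ### From dyadic to real times by monotonicity -/

/-- Dyadic approximation from below: `(⌊s 2ᵏ⌋₊ - 1 + 1)/2ᵏ → s` (natural subtraction; the
numerator is `⌊s 2ᵏ⌋₊` as soon as `s 2ᵏ ≥ 1`). [folklore] -/
theorem tendsto_nat_floor_pred_succ_div_two_pow {s : ℝ} (hs : 0 ≤ s) :
    Tendsto (fun k : ℕ => ((⌊s * 2 ^ k⌋₊ - 1 + 1 : ℕ) / 2 ^ k : ℝ)) atTop (𝓝 s) := by
  have hlow : ∀ k : ℕ, s - (2⁻¹ : ℝ) ^ k ≤ ((⌊s * 2 ^ k⌋₊ - 1 + 1 : ℕ) / 2 ^ k : ℝ) := fun k => by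
    rw [le_div_iff₀ (by positivity), sub_mul, inv_pow, inv_mul_cancel₀ (by positivity)]
    have h1 : (⌊s * 2 ^ k⌋₊ : ℝ) ≤ ((⌊s * 2 ^ k⌋₊ - 1 + 1 : ℕ) : ℝ) := by
      exact_mod_cast le_tsub_add
    have h2 : s * 2 ^ k - 1 ≤ (⌊s * 2 ^ k⌋₊ : ℝ) := by
      have := Nat.lt_floor_add_one (s * 2 ^ k)
      linarith
    linarith
  have hup : ∀ k : ℕ, ((⌊s * 2 ^ k⌋₊ - 1 + 1 : ℕ) / 2 ^ k : ℝ) ≤ s + (2⁻¹ : ℝ) ^ k := fun k => by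
    rw [div_le_iff₀ (by positivity), add_mul, inv_pow, inv_mul_cancel₀ (by positivity)]
    have h1 : ((⌊s * 2 ^ k⌋₊ - 1 + 1 : ℕ) : ℝ) ≤ (⌊s * 2 ^ k⌋₊ : ℝ) + 1 := by
      have : (⌊s * 2 ^ k⌋₊ - 1 + 1 : ℕ) ≤ ⌊s * 2 ^ k⌋₊ + 1 :=
        Nat.add_le_add_right (Nat.sub_le _ _) 1
      exact_mod_cast this
    have h2 : (⌊s * 2 ^ k⌋₊ : ℝ) ≤ s * 2 ^ k := Nat.floor_le (by positivity)
    linarith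
  have hlim₁ : Tendsto (fun k : ℕ => s + (2⁻¹ : ℝ) ^ k) atTop (𝓝 s) := by
    have := (tendsto_pow_atTop_nhds_zero_of_lt_one (r := (2⁻¹ : ℝ)) (by norm_num) (by norm_num))
    simpa using this.const_add s
  have hlim₂ : Tendsto (fun k : ℕ => s - (2⁻¹ : ℝ) ^ k) atTop (𝓝 s) := by
    have := (tendsto_pow_atTop_nhds_zero_of_lt_one (r := (2⁻¹ : ℝ)) (by norm_num) (by norm_num))
    simpa using this.const_sub s
  exact tendsto_of_tendsto_of_tendsto_of_le_of_le hlim₂ hlim₁ hlow hup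

/-- **Squeeze from dyadic to real times**: a function `f` antitone on `(0, ∞)` that coincides with a
function `g` continuous on `(0, ∞)` at every positive dyadic rational `(m+1)/2ᵏ` coincides with
`g` on `(0, ∞)` (approximate `s` by dyadics from both sides). [folklore] -/
theorem eq_of_antitone_of_dyadic {f g : ℝ → ℝ} (hf : ∀ s t : ℝ, 0 < s → s ≤ t → f t ≤ f s)
    (hg : ∀ s : ℝ, 0 < s → ContinuousAt g s)
    (h : ∀ m k : ℕ, f ((m + 1 : ℕ) / 2 ^ k : ℝ) = g ((m + 1 : ℕ) / 2 ^ k : ℝ)) {s : ℝ}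
    (hs : 0 < s) : f s = g s := by
  -- from above: `g (q k) = f (q k) ≤ f s`, `q k ↓ s`
  set q : ℕ → ℝ := fun k => ((⌊s * 2 ^ k⌋₊ + 1 : ℕ) / 2 ^ k : ℝ) with hq
  have hq_ge : ∀ k, s ≤ q k := fun k => by
    rw [hq]
    dsimp only
    rw [le_div_iff₀ (by positivity)]
    push_cast
    exact (Nat.lt_floor_add_one (s * 2 ^ k)).le
  have hq_t : Tendsto q atTop (𝓝 s) := by
    -- `s ≤ q k ≤ s + 2⁻ᵏ`
    have hup : ∀ k : ℕ, q k ≤ s + (2⁻¹ : ℝ) ^ k := fun k => by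
      rw [hq]
      dsimp only
      rw [div_le_iff₀ (by positivity), add_mul, inv_pow, inv_mul_cancel₀ (by positivity)]
      push_cast
      gcongr
      exact Nat.floor_le (by positivity)
    have hlim : Tendsto (fun k : ℕ => s + (2⁻¹ : ℝ) ^ k) atTop (𝓝 s) := by
      have := (tendsto_pow_atTop_nhds_zero_of_lt_one (r := (2⁻¹ : ℝ)) (by norm_num) (by norm_num))
      simpa using this.const_add s
    exact tendsto_of_tendsto_of_tendsto_of_le_of_le tendsto_const_nhds hlim hq_ge hup
  have hgq : Tendsto (fun k => g (q k)) atTop (𝓝 (g s)) := ((hg s hs).tendsto).comp hq_t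
  have h_le : g s ≤ f s := by
    refine le_of_tendsto' hgq fun k => ?_
    rw [← h]
    exact hf s _ hs (hq_ge k)
  -- from below: `f s ≤ f (p k) = g (p k)` eventually, `p k ↑ s`
  set p : ℕ → ℝ := fun k => ((⌊s * 2 ^ k⌋₊ - 1 + 1 : ℕ) / 2 ^ k : ℝ) with hp
  have hp_t : Tendsto p atTop (𝓝 s) := tendsto_nat_floor_pred_succ_div_two_pow hs.le
  have hgp : Tendsto (fun k => g (p k)) atTop (𝓝 (g s)) := ((hg s hs).tendsto).comp hp_t
  have hev : ∀ᶠ k : ℕ in atTop, 1 ≤ s * 2 ^ k :=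
    (Tendsto.const_mul_atTop hs (tendsto_pow_atTop_atTop_of_one_lt one_lt_two)).eventually_ge_atTop 1
  have h_ge : f s ≤ g s := by
    refine ge_of_tendsto hgp ?_
    filter_upwards [hev] with k hk
    have hfl : 1 ≤ ⌊s * 2 ^ k⌋₊ := Nat.one_le_floor_iff _ |>.2 hk
    have hpk : p k = (⌊s * 2 ^ k⌋₊ : ℝ) / 2 ^ k := by
      rw [hp]
      dsimp only
      rw [Nat.sub_add_cancel hfl]
    have hp_pos : 0 < p k := by
      rw [hpk]
      have : (0 : ℝ) < ⌊s * 2 ^ k⌋₊ := by exact_mod_cast hfl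
      positivity
    have hp_le : p k ≤ s := by
      rw [hpk, div_le_iff₀ (by positivity)]
      exact Nat.floor_le (by positivity)
    rw [← h]
    exact hf _ _ hp_pos hp_le
  exact le_antisymm h_ge h_le

/-- **The representation for all real times**: `Re ⟪ψ, S s ψ⟫ = ∫_{σ(S 1)} x^s dμ_ψ(x)` for every
`s > 0` (both sides are antitone resp. continuous in `s` and agree on the dyadic rationals;
Yosida (1980) IX.13, Chung–Zhao (1995) §2.4 (35), in the variable `x = e^{λ}`).
[cite: ChungZhao1995, §2.4 (35)] -/
theorem re_inner_eq_integral_rpow (hadd : ∀ s t : ℝ, 0 < s → 0 < t → S (s + t) = S s * S t)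
    (hsa : ∀ t : ℝ, 0 < t → IsSelfAdjoint (S t)) (hcontr : ∀ t : ℝ, 0 < t → ‖S t‖ ≤ 1) (ψ : H)
    {s : ℝ} (hs : 0 < s) :
    RCLike.re ⟪ψ, S s ψ⟫_ℂ =
      ∫ x, (x : ℝ) ^ s ∂(scalarSpectralMeasure (S 1) (hsa 1 one_pos) ψ) := by
  -- extend `f` by its value pattern: only `s > 0` matters for the squeeze lemma
  refine eq_of_antitone_of_dyadic (f := fun s => RCLike.re ⟪ψ, S s ψ⟫_ℂ)
    (g := fun s => ∫ x, (x : ℝ) ^ s ∂(scalarSpectralMeasure (S 1) (hsa 1 one_pos) ψ))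
    (fun s t hs' hst => re_inner_self_antitone hadd hsa hcontr ψ hs' hst)
    (fun s hs' => continuousAt_integral_rpow hadd hsa hcontr ψ hs')
    (fun m k => re_inner_dyadic_eq_integral hadd hsa ψ m k) hs

/-- Complex form: `⟪ψ, S s ψ⟫ = ∫ x^s dμ_ψ(x)` for `s > 0`. [folklore] -/
theorem inner_eq_integral_rpow (hadd : ∀ s t : ℝ, 0 < s → 0 < t → S (s + t) = S s * S t)
    (hsa : ∀ t : ℝ, 0 < t → IsSelfAdjoint (S t)) (hcontr : ∀ t : ℝ, 0 < t → ‖S t‖ ≤ 1) (ψ : H)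
    {s : ℝ} (hs : 0 < s) :
    ⟪ψ, S s ψ⟫_ℂ = ((∫ x, (x : ℝ) ^ s ∂(scalarSpectralMeasure (S 1) (hsa 1 one_pos) ψ) : ℝ) : ℂ) := by
  rw [inner_self_eq_re hadd hsa hs, re_inner_eq_integral_rpow hadd hsa hcontr ψ hs]

/-- Norm form: `‖S s ψ‖² = ∫ x^{2s} dμ_ψ(x)` for `s > 0`. [folklore] -/
theorem norm_sq_eq_integral_rpow (hadd : ∀ s t : ℝ, 0 < s → 0 < t → S (s + t) = S s * S t)
    (hsa : ∀ t : ℝ, 0 < t → IsSelfAdjoint (S t)) (hcontr : ∀ t : ℝ, 0 < t → ‖S t‖ ≤ 1) (ψ : H)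
    {s : ℝ} (hs : 0 < s) :
    ‖S s ψ‖ ^ 2 = ∫ x, (x : ℝ) ^ (2 * s) ∂(scalarSpectralMeasure (S 1) (hsa 1 one_pos) ψ) := by
  have h := re_inner_self_eq_norm_sq_half hadd hsa (t := 2 * s) (by positivity) ψ
  rw [mul_div_cancel_left₀ s two_ne_zero] at h
  rw [← h, re_inner_eq_integral_rpow hadd hsa hcontr ψ (by positivity)]

/-! ### The mass at `x = 0` and weak continuity at `t = 0` -/

/-- As `t → 0⁺`, `∫ x^t dμ_ψ → μ_ψ {x ≠ 0}` (dominated convergence: `x^t → 𝟙{x ≠ 0}` on `[0, 1]`).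
[folklore] -/
theorem tendsto_integral_rpow_zero (hadd : ∀ s t : ℝ, 0 < s → 0 < t → S (s + t) = S s * S t)
    (hsa : ∀ t : ℝ, 0 < t → IsSelfAdjoint (S t)) (hcontr : ∀ t : ℝ, 0 < t → ‖S t‖ ≤ 1) (ψ : H) :
    Tendsto (fun t : ℝ => ∫ x, (x : ℝ) ^ t ∂(scalarSpectralMeasure (S 1) (hsa 1 one_pos) ψ))
      (𝓝[>] 0) (𝓝 ((scalarSpectralMeasure (S 1) (hsa 1 one_pos) ψ).real
        {x | (x : ℝ) ≠ 0})) := by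
  set ν := scalarSpectralMeasure (S 1) (hsa 1 one_pos) ψ with hν
  have hms : MeasurableSet {x : spectrum ℝ (S 1) | (x : ℝ) ≠ 0} :=
    (measurable_subtype_coe (measurableSet_singleton (0 : ℝ))).compl
  have hlim : ν.real {x | (x : ℝ) ≠ 0} =
      ∫ x, ({x : spectrum ℝ (S 1) | (x : ℝ) ≠ 0}.indicator (fun _ => (1 : ℝ)) x) ∂ν := by
    rw [integral_indicator hms, setIntegral_const, smul_eq_mul, mul_one]
  rw [hlim]
  refine tendsto_integral_filter_of_dominated_convergence (bound := fun _ => 1) ?_ ?_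
    (integrable_const 1) ?_
  · filter_upwards [self_mem_nhdsWithin] with t ht
    exact (continuous_subtype_val.rpow_const fun x => Or.inr (le_of_lt ht)).aestronglyMeasurable
  · filter_upwards [self_mem_nhdsWithin] with t ht
    exact Eventually.of_forall fun x => by
      rw [Real.norm_eq_abs]
      exact abs_rpow_le_one hadd hsa hcontr x (le_of_lt ht)
  · refine Eventually.of_forall fun x => ?_
    by_cases hx : (x : ℝ) = 0
    · have hx' : x ∉ {x : spectrum ℝ (S 1) | (x : ℝ) ≠ 0} := fun h => h hx
      rw [Set.indicator_of_notMem hx']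
      refine (tendsto_const_nhds (x := (0 : ℝ))).congr' ?_
      filter_upwards [self_mem_nhdsWithin] with t ht
      rw [hx, Real.zero_rpow (ne_of_gt ht)]
    · have hx' : x ∈ {x : spectrum ℝ (S 1) | (x : ℝ) ≠ 0} := hx
      rw [Set.indicator_of_mem hx']
      have hc : ContinuousAt (fun t : ℝ => (x : ℝ) ^ t) 0 := Real.continuousAt_const_rpow hx
      have := hc.tendsto
      rw [Real.rpow_zero] at this
      exact this.mono_left nhdsWithin_le_nhds

/-- **No mass at `x = 0` under weak continuity at `t = 0`**: if `Re ⟪ψ, S t ψ⟫ → ‖ψ‖²` as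
`t → 0⁺`, then `μ_ψ {0} = 0` (the kernel of `S 1` is invisible to `ψ`; Chung–Zhao (1995) §2.4,
"`0` is not an eigenvalue of `P_t^D`", from strong continuity (33)). [folklore] -/
theorem measure_zero_eq_zero_of_tendsto
    (hadd : ∀ s t : ℝ, 0 < s → 0 < t → S (s + t) = S s * S t)
    (hsa : ∀ t : ℝ, 0 < t → IsSelfAdjoint (S t)) (hcontr : ∀ t : ℝ, 0 < t → ‖S t‖ ≤ 1) (ψ : H)
    (h0 : Tendsto (fun t : ℝ => RCLike.re ⟪ψ, S t ψ⟫_ℂ) (𝓝[>] 0) (𝓝 (‖ψ‖ ^ 2))) :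
    scalarSpectralMeasure (S 1) (hsa 1 one_pos) ψ {x | (x : ℝ) = 0} = 0 := by
  set ν := scalarSpectralMeasure (S 1) (hsa 1 one_pos) ψ with hν
  have hms : MeasurableSet {x : spectrum ℝ (S 1) | (x : ℝ) ≠ 0} :=
    (measurable_subtype_coe (measurableSet_singleton (0 : ℝ))).compl
  -- the two limits of `t ↦ ∫ x^t dν` along `t → 0⁺`
  have h1 := tendsto_integral_rpow_zero hadd hsa hcontr ψ
  have h2 : Tendsto (fun t : ℝ => ∫ x, (x : ℝ) ^ t ∂ν) (𝓝[>] 0) (𝓝 (‖ψ‖ ^ 2)) := by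
    refine h0.congr' ?_
    filter_upwards [self_mem_nhdsWithin] with t ht
    exact re_inner_eq_integral_rpow hadd hsa hcontr ψ ht
  have heq : ν.real {x | (x : ℝ) ≠ 0} = ‖ψ‖ ^ 2 := tendsto_nhds_unique h1 h2
  have huniv : ν.real Set.univ = ‖ψ‖ ^ 2 := scalarSpectralMeasure_univ_real _ _ ψ
  have hcompl : ({x : spectrum ℝ (S 1) | (x : ℝ) = 0} : Set (spectrum ℝ (S 1))) =
      ({x : spectrum ℝ (S 1) | (x : ℝ) ≠ 0} : Set (spectrum ℝ (S 1)))ᶜ := by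
    ext x
    simp only [Set.mem_setOf_eq, Set.mem_compl_iff, not_not]
  have hreal : ν.real {x | (x : ℝ) = 0} = 0 := by
    rw [hcompl, measureReal_compl hms, huniv, heq, sub_self]
  exact (measureReal_eq_zero_iff (measure_ne_top ν _)).1 hreal

/-! ### The Laplace representation -/

/-- **Laplace (spectral) representation of a symmetric contraction semigroup on a complex Hilbert
space.** Let `S t` (`t > 0`) be self-adjoint contractions with `S (s+t) = S s * S t`, and let
`ψ ∈ H` with `Re ⟪ψ, S t ψ⟫ → ‖ψ‖²` as `t → 0⁺`. Then there is a finite positive Borel measure `μ`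
on `ℝ`, carried by `[0, ∞)`, of total mass `‖ψ‖²`, with
`⟪ψ, S t ψ⟫ = ∫ e^{-tE} dμ(E)` and `‖S t ψ‖² = ∫ e^{-2tE} dμ(E)` for every `t > 0` — the spectral
measure of `ψ` for the generator, here constructed as the image under `x ↦ -log x` of the scalar
spectral measure of the positive contraction `S 1` (Yosida (1980) IX.13; Reed–Simon I Thm VIII.5
with §VII.2; Chung–Zhao (1995) §2.4 (35) "spectral resolution theorem for a semigroup of
self-adjoint operators in `L²`"). [cite: ChungZhao1995, §2.4 (35)] -/
theorem exists_laplace_measure (hadd : ∀ s t : ℝ, 0 < s → 0 < t → S (s + t) = S s * S t)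
    (hsa : ∀ t : ℝ, 0 < t → IsSelfAdjoint (S t)) (hcontr : ∀ t : ℝ, 0 < t → ‖S t‖ ≤ 1) (ψ : H)
    (h0 : Tendsto (fun t : ℝ => RCLike.re ⟪ψ, S t ψ⟫_ℂ) (𝓝[>] 0) (𝓝 (‖ψ‖ ^ 2))) :
    ∃ μ : Measure ℝ, IsFiniteMeasure μ ∧ μ (Set.Iio 0) = 0 ∧
      μ Set.univ = ENNReal.ofReal (‖ψ‖ ^ 2) ∧
      (∀ t : ℝ, 0 < t → ⟪ψ, S t ψ⟫_ℂ = ∫ E, (Real.exp (-(t * E)) : ℂ) ∂μ) ∧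
      (∀ t : ℝ, 0 < t → ‖S t ψ‖ ^ 2 = ∫ E, Real.exp (-(2 * t * E)) ∂μ) := by
  set ν := scalarSpectralMeasure (S 1) (hsa 1 one_pos) ψ with hν
  set g : spectrum ℝ (S 1) → ℝ := fun x => -Real.log (x : ℝ) with hg
  have hgm : Measurable g := (Real.measurable_log.comp measurable_subtype_coe).neg
  have hν0 : ν {x | (x : ℝ) = 0} = 0 := measure_zero_eq_zero_of_tendsto hadd hsa hcontr ψ h0
  -- `e^{-r g(x)} = x^r` for `ν`-a.e. `x` (all `x > 0`)
  have hae : ∀ r : ℝ, (fun x => Real.exp (-(r * g x))) =ᵐ[ν] fun x => (x : ℝ) ^ r := by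
    intro r
    have hν0' : ∀ᵐ x ∂ν, x ∉ ({x : spectrum ℝ (S 1) | (x : ℝ) = 0} : Set (spectrum ℝ (S 1))) :=
      measure_eq_zero_iff_ae_notMem.1 hν0
    filter_upwards [hν0'] with x hx
    have hx0 : (x : ℝ) ≠ 0 := hx
    have hxpos : 0 < (x : ℝ) := lt_of_le_of_ne (coe_mem_Icc hadd hsa hcontr x).1 (Ne.symm hx0)
    rw [hg]
    dsimp only
    rw [Real.rpow_def_of_pos hxpos, mul_neg, neg_neg, mul_comm]
  have hint : ∀ r : ℝ, ∫ E, Real.exp (-(r * E)) ∂(ν.map g) = ∫ x, (x : ℝ) ^ r ∂ν := by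
    intro r
    rw [integral_map hgm.aemeasurable (by fun_prop)]
    exact integral_congr_ae (hae r)
  refine ⟨ν.map g, inferInstance, ?_, ?_, ?_, ?_⟩
  · -- carried by `[0, ∞)`: `-log x < 0 ⇒ x > 1`, impossible on `σ(S 1) ⊆ [0,1]`
    rw [Measure.map_apply hgm measurableSet_Iio]
    have : g ⁻¹' Set.Iio 0 = ∅ := by
      ext x
      simp only [Set.mem_preimage, Set.mem_Iio, Set.mem_empty_iff_false, iff_false, not_lt, hg,
        Left.nonneg_neg_iff]
      obtain ⟨h0', h1'⟩ := coe_mem_Icc hadd hsa hcontr x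
      exact Real.log_nonpos h0' h1'
    rw [this, measure_empty]
  · rw [Measure.map_apply hgm MeasurableSet.univ, Set.preimage_univ, hν,
      scalarSpectralMeasure_univ]
  · intro t ht
    rw [integral_complex_ofReal, hint t, inner_eq_integral_rpow hadd hsa hcontr ψ ht]
  · intro t ht
    have h := hint (2 * t)
    have h' : (fun E => Real.exp (-(2 * t * E))) = fun E => Real.exp (-((2 * t) * E)) := rfl
    rw [h', h, norm_sq_eq_integral_rpow hadd hsa hcontr ψ ht]

end SymmContractionSemigroup

end Literature.Analysis.OperatorTheory

end
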